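import Literature.Geometry.Riemannian.GradientShrinkerProofs
import Literature.Geometry.Riemannian.ChangGurskyYangRegularity
import Literature.Geometry.Lorentzian.MetricNormSq
import HarnessLib

/-!
# `∫|Hess f|² dV = ½ ∫(R − 2)² dV` on a closed four-dimensional gradient shrinker
(stub `stub_hessianEnergy_of_identities` of line `cgy-variance-pivot`, crux
`EntropyRung.CompactShrinkerGap`, item stmt-SmoothPoincare4-10870)

For a Riemannian metric `g` (Levi-Civita connection) on a closed `4`-manifold and a smooth `f`
with `Ric + Hess f = g/2`, GIVEN the two pointwise identities
(B) `ΔR = g⁻¹(dR, df) + R − 2|Ric|²` and (H) `|Hess f|² = |Ric|² + 1 − R`,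
the unweighted Hessian energy is half the scalar-curvature variance:
`∫_M |Hess f|²_g dV_g = ½ ∫_M (R − 2)² dV_g`
(Cheng–Ribeiro–Zhou, Lemma 1 and p. 5; Cao–Zhu 2010, (3.6)–(3.7)). This is the integrated
dictionary entry turning the variance budget `D = ∫(R − 2)² dV < 2 Vol − 96π²` of the line into
`∫|Hess f|² dV < Vol − 48π²`.

Proof (measure/integral bookkeeping only, all integrands continuous on a compact manifold of
finite volume): the trace `R + Δf = 2` of the soliton equation
(`IsGradientShrinker.scalarCurvature_add_dalembertian_one`, `finrank ℝ ℝ⁴ = 4`) and `∫Δf dV = 0`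
(`integral_dalembertian_riemVolume_eq_zero`) give `∫R dV = 2 Vol`; Green's first identity
(`integral_mul_dalembertian_riemVolume`) gives `∫ g⁻¹(dR, df) dV = −∫ R Δf dV = ∫R² dV − 4 Vol`;
integrating (B) with `∫ΔR dV = 0` gives `∫|Ric|² dV = ½∫R² dV − Vol`; integrating (H) gives
`∫|Hess f|² dV = ∫|Ric|² dV + Vol − ∫R dV = ½∫R² dV − 2 Vol = ½∫(R − 2)² dV`, with
`riemVolume_eq` to pass between `g.riemVolume` and the Riemannian measure.
Everything is proved; no definition, no named fact.

References: X. Cheng, E. Ribeiro Jr, D. Zhou, arXiv:2203.14916, Lemma 1 and p. 5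
[ChengRibeiroZhou2022]; H.-D. Cao, M. Zhu, arXiv:1008.0842, (3.6)–(3.7) [CaoZhu2010];
J. M. Lee, *Introduction to Riemannian Manifolds* (2018), Problem 2-23 [Lee2018].
-/

noncomputable section

-- the registered namespace `Summit.SmoothPoincare4.SmoothPoincare4.Theorems` repeats a component
set_option linter.dupNamespace false

open Bundle Set Function Filter Module MeasureTheory
open scoped Manifold ContDiff Topology

namespace Summit.SmoothPoincare4.SmoothPoincare4.Theorems

open Literature.Geometry Literature.Geometry.Lorentzian Literature.Geometry.Riemannian
  Literature.Geometry.Lorentzian.PseudoRiemannianMetric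

/-- **STUB `stub_hessianEnergy_of_identities` of line `cgy-variance-pivot` — the unweighted
Hessian energy of a closed gradient shrinker is half the scalar-curvature variance.** On a CLOSED
4-manifold with Riemannian `g` (Levi-Civita), smooth `f`, `Ric + Hess f = g/2`, and GIVEN the
identities (B) `ΔR = g⁻¹(dR, df) + R − 2|Ric|²` and (H) `|Hess f|² = |Ric|² + 1 − R` for this
`(g, f)`: `∫|Hess f|² dV = ½ ∫(R − 2)² dV`. Proof: `R + Δf = 2`
(`IsGradientShrinker.scalarCurvature_add_dalembertian_one`, `finrank = 4`) and `∫Δf = 0`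
(`integral_dalembertian_riemVolume_eq_zero`) give `∫R = 2V`; integrating (B) with `∫ΔR = 0` and
Green's first identity `∫ g⁻¹(dR, df) = −∫ R Δf = ∫R² − 4V` (`integral_mul_dalembertian_riemVolume`)
gives `∫|Ric|² = ½∫R² − V`; integrating (H) gives `∫|Hess f|² = ∫|Ric|² + V − ∫R = ½∫R² − 2V`,
while `∫(R − 2)² = ∫R² − 4∫R + 4V = ∫R² − 4V`; `riemVolume_eq`.
Check: round `S⁴(√6)` (`R ≡ 2`, `Hess f = 0`): `0 = 0`.
[cite: ChengRibeiroZhou2022, Lemma 1 and p. 5] [cite: CaoZhu2010, (3.6)–(3.7)] -/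
theorem stub_hessianEnergy_of_identities :
    ∀ (M : Type) [TopologicalSpace M] [T2Space M] [SecondCountableTopology M]
      [ChartedSpace (EuclideanSpace ℝ (Fin 4)) M] [IsManifold (𝓡 4) ∞ M] [CompactSpace M]
      [T3Space M] [MeasurableSpace M] [BorelSpace M]
      (g : Literature.Geometry.Lorentzian.PseudoRiemannianMetric (𝓡 4) ∞ (EuclideanSpace ℝ (Fin 4))
        (TangentSpace (𝓡 4) : M → Type _)) [g.HasLeviCivita] (f : M → ℝ) (hg : g.IsRiemannian),
      ContMDiff (𝓡 4) 𝓘(ℝ, ℝ) ∞ f →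
      (∀ (x : M) (X Y : TangentSpace (𝓡 4) x),
        g.ricci x X Y + g.hessian f x X Y = (1 / 2 : ℝ) * g.val x X Y) →
      (∀ x : M, g.dalembertian g.scalarCurvature x =
        g.innerDual x (mvfderiv (𝓡 4) g.scalarCurvature x : TangentSpace (𝓡 4) x →ₗ[ℝ] ℝ)
            (mvfderiv (𝓡 4) f x : TangentSpace (𝓡 4) x →ₗ[ℝ] ℝ) +
          g.scalarCurvature x - 2 * g.normSq x (g.ricci x)) →
      (∀ x : M, g.normSq x (g.hessian f x) = g.normSq x (g.ricci x) + 1 - g.scalarCurvature x) →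
      ∫ x, g.normSq x (g.hessian f x)
          ∂(Literature.Geometry.Lorentzian.riemannianMeasure (g.toContMDiffRiemannianMetric hg)) =
        1 / 2 * ∫ x, (g.scalarCurvature x - 2) ^ 2
          ∂(Literature.Geometry.Lorentzian.riemannianMeasure (g.toContMDiffRiemannianMetric hg)) := by
  intro M _ _ _ _ _ _ _ _ _ g _ f hg hf hsol hB hH
  -- the Riemannian measure is `g.riemVolume`, a finite measure
  have hV : g.riemVolume = riemannianMeasure (g.toContMDiffRiemannianMetric hg) :=
    PseudoRiemannianMetric.riemVolume_eq hg
  haveI : IsFiniteMeasure g.riemVolume := ⟨g.riemVolume_univ_lt_top⟩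
  have hE : finrank ℝ (EuclideanSpace ℝ (Fin 4)) = 4 := finrank_euclideanSpace_fin
  rw [← hV]
  -- regularity of `R` and `f`
  have hR : ContMDiff (𝓡 4) 𝓘(ℝ, ℝ) ∞ g.scalarCurvature := g.contMDiff_scalarCurvature
  have hR1 : ContMDiff (𝓡 4) 𝓘(ℝ, ℝ) 1 g.scalarCurvature := hR.of_le (by norm_num)
  have hR2 : ContMDiff (𝓡 4) 𝓘(ℝ, ℝ) 2 g.scalarCurvature :=
    hR.of_le (WithTop.coe_le_coe.mpr le_top)
  have hf1 : ContMDiff (𝓡 4) 𝓘(ℝ, ℝ) 1 f := hf.of_le (by norm_num)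
  have hf2 : ContMDiff (𝓡 4) 𝓘(ℝ, ℝ) 2 f := hf.of_le (WithTop.coe_le_coe.mpr le_top)
  -- continuity, hence integrability, of every integrand
  have hRc : Continuous g.scalarCurvature := hR.continuous
  have hIc : Continuous fun x ↦ g.innerDual x
      (mvfderiv (𝓡 4) g.scalarCurvature x : TangentSpace (𝓡 4) x →ₗ[ℝ] ℝ)
      (mvfderiv (𝓡 4) f x : TangentSpace (𝓡 4) x →ₗ[ℝ] ℝ) :=
    continuous_innerDual_mvfderiv g hR1 hf1
  have hQc : Continuous fun x ↦ g.normSq x (g.ricci x) := g.contMDiff_normSq_ricci'.continuous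
  have iR : Integrable g.scalarCurvature g.riemVolume := g.integrable_of_continuous hRc
  have iR2 : Integrable (fun x ↦ g.scalarCurvature x ^ 2) g.riemVolume :=
    g.integrable_of_continuous (hRc.pow 2)
  have iP : Integrable (fun x ↦ g.innerDual x
      (mvfderiv (𝓡 4) g.scalarCurvature x : TangentSpace (𝓡 4) x →ₗ[ℝ] ℝ)
      (mvfderiv (𝓡 4) f x : TangentSpace (𝓡 4) x →ₗ[ℝ] ℝ)) g.riemVolume :=
    g.integrable_of_continuous hIc
  have iQ : Integrable (fun x ↦ g.normSq x (g.ricci x)) g.riemVolume :=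
    g.integrable_of_continuous hQc
  have i2R : Integrable (fun x ↦ 2 * g.scalarCurvature x) g.riemVolume := iR.const_mul 2
  have i4R : Integrable (fun x ↦ 4 * g.scalarCurvature x) g.riemVolume := iR.const_mul 4
  have i2Q : Integrable (fun x ↦ 2 * g.normSq x (g.ricci x)) g.riemVolume := iQ.const_mul 2
  have iPR : Integrable (fun x ↦ g.innerDual x
      (mvfderiv (𝓡 4) g.scalarCurvature x : TangentSpace (𝓡 4) x →ₗ[ℝ] ℝ)
      (mvfderiv (𝓡 4) f x : TangentSpace (𝓡 4) x →ₗ[ℝ] ℝ) + g.scalarCurvature x) g.riemVolume :=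
    iP.add iR
  have iQ1 : Integrable (fun x ↦ g.normSq x (g.ricci x) + 1) g.riemVolume :=
    iQ.add (integrable_const _)
  -- the traced soliton equation `R + Δf = 2`
  have hshr : g.IsGradientShrinker f 1 := (g.isGradientShrinker_one_iff f).2 hsol
  have hΔf : ∀ x, g.dalembertian f x = 2 - g.scalarCurvature x := fun x ↦ by
    have h := hshr.scalarCurvature_add_dalembertian_one x
    rw [hE] at h
    norm_num at h
    linarith
  -- (1) `∫ Δf = 0`, i.e. `∫ R = 2 Vol`
  have e1 : ∫ x, g.scalarCurvature x ∂g.riemVolume = 2 * (g.riemVolume univ).toReal := by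
    have h0 := integral_dalembertian_riemVolume_eq_zero g hg hf2
    simp_rw [hΔf] at h0
    rw [integral_sub (integrable_const _) iR, integral_const, smul_eq_mul, Measure.real] at h0
    linarith
  -- (2) Green: `∫ g⁻¹(dR, df) = −∫ R Δf = ∫ R² − 2∫R`
  have e2 : ∫ x, g.innerDual x
      (mvfderiv (𝓡 4) g.scalarCurvature x : TangentSpace (𝓡 4) x →ₗ[ℝ] ℝ)
      (mvfderiv (𝓡 4) f x : TangentSpace (𝓡 4) x →ₗ[ℝ] ℝ) ∂g.riemVolume =
      ∫ x, g.scalarCurvature x ^ 2 ∂g.riemVolume - 2 * ∫ x, g.scalarCurvature x ∂g.riemVolume := by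
    have h0 := integral_mul_dalembertian_riemVolume g hg hR1 hf2
    simp_rw [hΔf] at h0
    have h1 : (fun x ↦ g.scalarCurvature x * (2 - g.scalarCurvature x)) =
        fun x ↦ 2 * g.scalarCurvature x - g.scalarCurvature x ^ 2 := by
      funext x
      ring
    rw [h1, integral_sub i2R iR2, integral_const_mul] at h0
    linarith
  -- (3) integrating (B): `∫ g⁻¹(dR, df) + ∫ R − 2∫|Ric|² = ∫ ΔR = 0`
  have e3 : ∫ x, g.innerDual x
      (mvfderiv (𝓡 4) g.scalarCurvature x : TangentSpace (𝓡 4) x →ₗ[ℝ] ℝ)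
      (mvfderiv (𝓡 4) f x : TangentSpace (𝓡 4) x →ₗ[ℝ] ℝ) ∂g.riemVolume +
      ∫ x, g.scalarCurvature x ∂g.riemVolume -
      2 * ∫ x, g.normSq x (g.ricci x) ∂g.riemVolume = 0 := by
    have h0 := integral_dalembertian_riemVolume_eq_zero g hg hR2
    simp_rw [hB] at h0
    rwa [integral_sub iPR i2Q, integral_add iP iR, integral_const_mul] at h0
  -- (4) integrating (H): `∫|Hess f|² = ∫|Ric|² + Vol − ∫R`
  have e4 : ∫ x, g.normSq x (g.hessian f x) ∂g.riemVolume =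
      ∫ x, g.normSq x (g.ricci x) ∂g.riemVolume + (g.riemVolume univ).toReal -
        ∫ x, g.scalarCurvature x ∂g.riemVolume := by
    rw [integral_congr_ae (ae_of_all _ hH), integral_sub iQ1 iR, integral_add iQ (integrable_const _),
      integral_const, smul_eq_mul, Measure.real]
    ring
  -- (5) `∫ (R − 2)² = ∫R² − 4∫R + 4 Vol`
  have e5 : ∫ x, (g.scalarCurvature x - 2) ^ 2 ∂g.riemVolume =
      ∫ x, g.scalarCurvature x ^ 2 ∂g.riemVolume - 4 * ∫ x, g.scalarCurvature x ∂g.riemVolume +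
        4 * (g.riemVolume univ).toReal := by
    have h1 : (fun x ↦ (g.scalarCurvature x - 2) ^ 2) =
        fun x ↦ g.scalarCurvature x ^ 2 - 4 * g.scalarCurvature x + 4 := by
      funext x
      ring
    have i₁ : Integrable (fun x ↦ g.scalarCurvature x ^ 2 - 4 * g.scalarCurvature x)
        g.riemVolume := iR2.sub i4R
    rw [h1, integral_add i₁ (integrable_const _), integral_sub iR2 i4R, integral_const_mul,
      integral_const, smul_eq_mul, Measure.real]
    ring
  rw [e4, e5]
  linarith [e1, e2, e3]

end Summit.SmoothPoincare4.SmoothPoincare4.Theorems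

end
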